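import Summits.CriticalPhenomena.PercolationContinuityZ3.Theorems.Transplant.PlanarSkeletonCriticalProbLtOne
import HarnessLib

/-!
# D″ node, option S (lead 05:51:21Z; DPRIME-SCOPE addendum N.2): THE SINGLE-TYPE NODE `SamePDropOfSkeletonSign₁` — `SamePDropOfSkeletonSign`
# restricted to skeletons with ONE base vertex type (`Φ.types = {t}`, hypothesis form: no new structure), the TARGET OF RECORD of the D″
# programme (every §4 customer is vertex-transitive); its minimal / critical forms and the subexponential entry point

builds on p205010 (kernel theorem, internal audit signed; external expert review pending) — nothing in this file uses p205010.
Lane `prim-bschramm`, seat `prim-bschramm-p3` (gen 7; D″ design owner); helper file (`--supports stmt-CriticalPhenomena-4575`).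
WHY: the two-unit cells need ONE monotone band (`TwoAxis.exists_twoUnit(L)`); Step I′ over several frame types only yields the envelope of
the per-type bands, for which the two-unit pair need not exist (stmt-g9 05:44:21Z, abstract counterexample).  With one type the band of the
data IS the band of `t` (`Skelφ.exists_stepI_single'`, 8th fact), and nothing else changes.  The multi-type node (p244708) stays a conjecture.
* `SamePDropOfSkeletonSign₁`; `samePDropOfSkeletonSign₁_of_sign` (the multi-type node implies it);
* `samePDropOfSkeletonSign₁_iff_critical`, `samePDropOfSkeletonSign₁_iff_minimal'` (↔ `∀ G Φ, ∀ t ∈ types, types = {t} → Φ2(p_c) → θ_t(p_c) = 0`);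
* **`samePDropOfSkeletonSign₁_of_subexponential_case'`** (Hutchcroft off exponential growth — the entry point of the closure of record);
* `continuity_of_signNode₁` (the instances' one-liner: `types = {t}`, Φ2 at `p_c` ⟹ `θ_t(p_c) = 0`).
[cite: BenjaminiSchramm1996, Conj. 4] [cite: Hutchcroft2016, Thm. 1] [cite: LyonsPeres2016, Thm. 7.6] [cite: KozmaNitzan2024, §1 p. 2 (approach 1)]
-/

noncomputable section

namespace Summit.CriticalPhenomena.PercolationContinuityZ3.Theorems.Transplant

open MeasureTheory Literature.Probability.Percolation Literature.Probability.LatticeModels SimpleGraph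
open Literature.Barriers.CriticalPhenomena (IsQuasiTransitive countable_of_connected_of_locallyFinite)
open Literature.Barriers.CriticalPhenomena (HasExponentialGrowth Hutchcroft2016_noPercolationAtCriticality_holds IsGraphAmenable
  hasExponentialGrowth_of_not_isGraphAmenable BurtonKeane1989_atMostOneInfiniteCluster_holds)
open scoped Classical

/-- **THE SINGLE-TYPE D″ NODE** (target of record, option S): on a connected locally finite graph with a `PlanarSkeletonSign` having ONE base
vertex type, at every density `p < 1` with a.s. uniqueness, subcritical cylinders and `θ_t(p) > 0`, some `q < p` still has `θ_t(q) > 0`.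
Same body as `SamePDropOfSkeletonSign` (p244708) with the extra hypothesis `Φ.types = {t}`; it is implied by that node
(`samePDropOfSkeletonSign₁_of_sign`).  A conjecture node of THIS programme (to be closed by the D″ chain), not a published fact — the special
case of Benjamini–Schramm's Conjecture 4 it expresses is cited on the theorems below. [this work] -/
@[conjecture] def SamePDropOfSkeletonSign₁ : Prop :=
  ∀ {V : Type} [DecidableEq V] [Countable V] (G : SimpleGraph V) [G.LocallyFinite] (Φ : PlanarSkeletonSign G),
    G.Connected → ∀ t ∈ Φ.types, Φ.types = {t} → ∀ p : unitInterval, (p : ℝ) < 1 →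
      (∀ᵐ ω ∂bondPercolation G p, numInfiniteClusters ω ≤ 1) → Φ.CylSubcritical p → 0 < theta G t p →
        ∃ q : unitInterval, (q : ℝ) < p ∧ 0 < theta G t q

/-- The multi-type node implies the single-type node (forget the extra hypothesis). [folklore] -/
theorem samePDropOfSkeletonSign₁_of_sign (h : SamePDropOfSkeletonSign) : SamePDropOfSkeletonSign₁ :=
  fun G _ Φ hc t ht _ p hp hU hC hθ => h G Φ hc t ht p hp hU hC hθ

/-- **Normal form at criticality**: the single-type node has content at `p = p_c` only. [cite: BenjaminiSchramm1996, Conj. 4] -/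
theorem samePDropOfSkeletonSign₁_iff_critical : SamePDropOfSkeletonSign₁ ↔
    ∀ {V : Type} [DecidableEq V] [Countable V] (G : SimpleGraph V) [G.LocallyFinite] (Φ : PlanarSkeletonSign G),
      G.Connected → ∀ t ∈ Φ.types, Φ.types = {t} → criticalProb G t < 1 →
        (∀ᵐ ω ∂bondPercolation G (criticalProbIOf G t), numInfiniteClusters ω ≤ 1) →
          Φ.CylSubcritical (criticalProbIOf G t) → theta G t (criticalProbIOf G t) = 0 := by
  constructor
  · intro hD V _ _ G _ Φ hc t ht h1 hpc hU hC
    exact theta_criticalProbIOf_eq_zero_of_drop_at G t fun hpos => hD G Φ hc t ht h1 _ (by exact hpc) hU hC hpos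
  · intro hK V _ _ G _ Φ hc t ht h1 p hp1 hU hC hθ
    have hge : criticalProb G t ≤ p :=
      not_lt.1 fun hlt => hθ.ne' (theta_eq_zero_of_lt_criticalProb_holds G t p hlt)
    rcases hge.lt_or_eq with hlt | heq
    · have hpc0 : 0 ≤ criticalProb G t := (criticalProb_mem_Icc G t).1
      have hp0 : 0 ≤ (p : ℝ) := p.2.1
      have hq1 : (criticalProb G t + p) / 2 ≤ 1 := by linarith [p.2.2]
      refine ⟨⟨(criticalProb G t + p) / 2, by positivity, hq1⟩, ?_, ?_⟩
      · show (criticalProb G t + (p : ℝ)) / 2 < p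
        linarith
      · exact theta_pos_of_criticalProb_lt_holds G t _
          (by show criticalProb G t < (criticalProb G t + (p : ℝ)) / 2; linarith)
    · exfalso
      have e : p = criticalProbIOf G t := Subtype.ext heq.symm
      subst e
      exact hθ.ne' (hK G Φ hc t ht h1 (by exact hp1) hU hC)

/-- **The single-type node in minimal form**: ↔ `θ_t(p_c) = 0` for every locally finite `G` with a one-type `PlanarSkeletonSign` and Φ2 at
`p_c` — connectedness, countability, quasi-transitivity, uniqueness and `p_c < 1` are supplied by the skeleton (growth split: Hutchcroft /
Burton–Keane). [cite: BenjaminiSchramm1996, Conj. 4] [cite: Hutchcroft2016, Thm. 1] [cite: LyonsPeres2016, Thm. 7.6] -/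
theorem samePDropOfSkeletonSign₁_iff_minimal' : SamePDropOfSkeletonSign₁ ↔
    ∀ {V : Type} (G : SimpleGraph V) [G.LocallyFinite] (Φ : PlanarSkeletonSign G), ∀ t ∈ Φ.types, Φ.types = {t} →
      Φ.CylSubcritical (criticalProbIOf G t) → theta G t (criticalProbIOf G t) = 0 := by
  rw [samePDropOfSkeletonSign₁_iff_critical]
  constructor
  · intro hK V G _ Φ t ht h1 hC
    have hc : G.Connected := Φ.toPlanarSkeletonNeg.graph_connected t
    haveI : Countable V := countable_of_connected_of_locallyFinite G hc t
    have hq : IsQuasiTransitive G := Φ.toPlanarSkeletonNeg.isQuasiTransitive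
    by_cases hg : HasExponentialGrowth G
    · exact Hutchcroft2016_noPercolationAtCriticality_holds G hc hq hg t
    · have ha : IsGraphAmenable G := by_contra fun hna => hg (hasExponentialGrowth_of_not_isGraphAmenable G hq hna)
      exact hK G Φ hc t ht h1 (Φ.criticalProb_lt_one t) (BurtonKeane1989_atMostOneInfiniteCluster_holds G hc hq ha _) hC
  · intro h V _ _ G _ Φ _ t ht h1 _ _ hC
    exact h G Φ t ht h1 hC

/-- **ENTRY POINT OF THE CLOSURE OF RECORD**: to prove the single-type node it suffices to treat graphs NOT of exponential growth, one-type
skeletons, under Φ2 at `p_c`. [cite: Hutchcroft2016, Thm. 1] [cite: BenjaminiSchramm1996, Conj. 4] -/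
theorem samePDropOfSkeletonSign₁_of_subexponential_case'
    (h : ∀ {V : Type} (G : SimpleGraph V) [G.LocallyFinite] (Φ : PlanarSkeletonSign G), ¬ HasExponentialGrowth G →
      ∀ t ∈ Φ.types, Φ.types = {t} → Φ.CylSubcritical (criticalProbIOf G t) → theta G t (criticalProbIOf G t) = 0) :
    SamePDropOfSkeletonSign₁ := by
  refine samePDropOfSkeletonSign₁_iff_minimal'.2 fun G _ Φ t ht h1 hC => ?_
  by_cases hg : HasExponentialGrowth G
  · exact Hutchcroft2016_noPercolationAtCriticality_holds G (Φ.toPlanarSkeletonNeg.graph_connected t)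
      Φ.toPlanarSkeletonNeg.isQuasiTransitive hg t
  · exact h G Φ hg t ht h1 hC

/-- **Conditional continuity from the single-type node** (the instances' one-liner): one type, Φ2 at `p_c` ⟹ `θ_t(p_c) = 0`.
[cite: BenjaminiSchramm1996, Conj. 4] -/
theorem continuity_of_signNode₁ (hD : SamePDropOfSkeletonSign₁) {V : Type} (G : SimpleGraph V) [G.LocallyFinite]
    (Φ : PlanarSkeletonSign G) {t : V} (ht : t ∈ Φ.types) (h1 : Φ.types = {t}) (hC : Φ.CylSubcritical (criticalProbIOf G t)) :
    theta G t (criticalProbIOf G t) = 0 :=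
  samePDropOfSkeletonSign₁_iff_minimal'.1 hD G Φ t ht h1 hC

end Summit.CriticalPhenomena.PercolationContinuityZ3.Theorems.Transplant

end
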